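import Summits.QuantumFields.YangMills.Theorems.BalabanUVNodesN07LieTokAtOfRecordTwo
import Summits.QuantumFields.YangMills.Theorems.BalabanUVNodesN07Delta2OfRecordUnique
import HarnessLib

/-!
# NODE N07 — THE (3.134) DATUM `Δ⁽²⁾` RESPECTS THE TRACE SECTORS, FROM ITS TOKENS ALONE: under `Delta2Tok ∧ Delta2SymmTok` (no guard, every `N`) the `L²` operator `Δ2` KILLS the
# scalar-valued fields and has TRACELESS-valued range, hence commutes with the scalar part `S` — by polarisation of the quadratic form «`⟨A, Δ⁽²⁾A⟩ = −2⟨HC⁽²⁾(A), J⟩`», whose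
# right side is blind to scalar directions (✓`quadPart_CslOfRecord_add`); this DISCHARGES the displayed data row `hΔ2S` of ✓`schemeTokOfRecord_two_of_regimeTok`
# ([B9] (3.134)–(3.135) p. 422; [15] (56) p. 286, (78)–(79) p. 290, (27) p. 282, (51) p. 286)

Cell `pub-ymgap`, width seat `pub-ymgap-dag-n07-w3` (g27), CLAIM-7.  `--kind proof --supports stmt-QuantumFields-27238 --as helper`; count-neutral.
[15] = [Balaban1985Variational]; [B9] = [Balaban1985BackgroundPropagators].

THE ARGUMENT.  Write `q(Y) := ⟨Δ2̂Y, Y⟩₍₂₇₎` and `B(Y, Z) := ⟨Δ2̂Y, Z⟩₍₂₇₎` (symmetric by `Delta2SymmTok`).  For a scalar-presented `δ` (`Pδ = 0`), `Delta2Tok` and `C⁽²⁾(Y + δ) = C⁽²⁾(Y)` give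
`q(Y + δ) = q(Y)` and `q(δ) = q(0) = 0`, so `2B(Y, δ) = q(Y + δ) − q(Y) − q(δ) = 0`.  Testing with `δ = δ_b·1` makes every `Δ2̂Y` traceless; `B(δ, ·) = 0` and the perfectness of (27)
(✓`eq_of_forall_pair27_eq`) make `Δ2̂δ = 0`; reading back on `L²` (✓`exists_hat_eq`: `Y ↦ Ŷ` onto) gives `S ∘ Δ2 = 0 = Δ2 ∘ S`.
* §1 `pair27_delta2Cur_add_scalar`, `pair27_delta2Cur_scalar_self`, ★`pair27_delta2Cur_scalar_right`, `pair27_delta2Cur_scalar_left`.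
* §2 ★`delta2Cur_scalar_eq_zero`, ★`trace_delta2Cur_eq_zero`.
* §3 ★★`delta2_scalPartW_eq_zero`, ★★`scalPartW_delta2_eq_zero`, ★★★`scalPartW_comm_delta2_of_tok` (the row `hΔ2S`), and ★★★`schemeTokOfRecord_two_of_regimeTok'` (✓p825526 with that row removed).

HONEST LABELS.  Finite-dimensional linear algebra over the displayed tokens; no estimate; nothing of `RegimeTok` is proved.  Count-neutral; N07 NOT discharged; P0 ⟨26900⟩ OPEN; R4 is the
conditional finite-𝕋⁴ rung only.  Nothing here is a claim about the Yang–Mills mass gap (`Summit.QuantumFields`): finite torus, fixed `ε`; nothing continuum ∕ OS ∕ Clay.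
-/

set_option autoImplicit false

noncomputable section

open scoped Matrix Matrix.Norms.L2Operator InnerProductSpace ComplexConjugate BigOperators Topology

namespace Summit.QuantumFields.YangMills.Theorems.N07Delta2OfRecordTraceSectors

open Literature.MathematicalPhysics.QuantumFieldTheory.Balaban1983to89
open Literature.MathematicalPhysics.QuantumFieldTheory.Balaban1983to89.T4Continuum (T4Family)
open T4Continuum BlockAveraging
open B9SectCLatticeCarrier (Bond)
open B9Eq311L2Pairing (WL2)
open B9Eq311TracePairing (starW)
open B9Eq3119DeltaPiCarrier (currentCLM equiv_currentCLM)
open B11Eq103H1Complex (SiteL2K BondL2K funEquiv funEquiv_apply)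
open B11Eq111FrakG (nabla115)
open B11Eq115Space (NegSize NegSup levWeight JetSup)
open B11Eq90V0primeCurrent (flat115 flat115_apply)
open B11Eq90Transpose (pair27 pair27_eq_sum pair27_add_left pair27_add_right pair27_single single115 flat115_single115)
open B11Eq80Current (quadPart)
open B11Eq174Chart (Regime)
open B11Prop6Scheme (Prop4Hyp)
open Node00
open Summit.QuantumFields.YangMills.Theorems.N07TraceSectorDefs (scalPartW)
open Summit.QuantumFields.YangMills.Theorems.N07TraceSectorProjection (scalPartW_scalar scalPartW_eq_zero_iff)
open Summit.QuantumFields.YangMills.Theorems.N07CslOfRecordTraceSectors (quadPart_CslOfRecord_add slProjLit_eq_zero_of_scalar)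
open Summit.QuantumFields.YangMills.Theorems.N07W23OfRecordRealSlice (eq_of_forall_pair27_eq)
open Summit.QuantumFields.YangMills.Theorems.N07W23OfRecordTraceSectors (slProjLit_single115_one)
open Summit.QuantumFields.YangMills.Theorems.N07Delta2OfRecordUnique (exists_hat_eq)
open Summit.QuantumFields.YangMills.Theorems.N07LieTokAtOfRecordTwo (chartSUTok_bgSchemeOfRecord_two)
open Summit.QuantumFields.YangMills.Theorems.N07QuadPartReality (realConj_delta2_eq_self)
open B9Eq3119DeltaPiReality (realConj_eq_self_iff)
open Summit.QuantumFields.YangMills.Theorems.N07SchemeTokBundleOfRecord (schemeTokOfRecord_of_regimeTok_of_chartSUTok)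

section Tok

variable (F : T4Family) (N : ℕ) [NeZero N] (K : ℕ) (k : ℕ) (Ω : ℕ → Set (Site (F.P K) 0)) (U₀ : GaugeField (F.P K) 0 (SU N))
  [Fact (0 < (F.L : ℝ))] [Fact (0 < (F.P K).eta k)] [Fact (0 < c0Rec F K k)] [Fact (∀ c, 0 < wBRec F K k c)]
  (levB : PBond (F.P K) k → ℕ) (a : ℝ)
  (hposb : ∀ x, x ≠ 0 → 0 < RCLike.re ⟪x, laplaceAOfRecord F N k U₀ (QOfRecord F N k U₀) (QflatOfRecord F N k) a x⟫_ℂ)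
  (hQ : Function.Surjective (QOfRecord F N k U₀))
  {Δ2 : BondL2K ℂ (F.P K).d (fun _ => (F.P K).sitesPerDir 0) (c0Rec F K k) (WRec N) →ₗ[ℂ]
    BondL2K ℂ (F.P K).d (fun _ => (F.P K).sitesPerDir 0) (c0Rec F K k) (WRec N)}

/-! ## §1  The quadratic form of (3.134) and its polar form against scalar directions -/

omit [NeZero N] [Fact (0 < (F.L : ℝ))] [Fact (0 < (F.P K).eta k)] [Fact (0 < c0Rec F K k)] [Fact (∀ c, 0 < wBRec F K k c)] in
/-- Bookkeeping: the zero current pairs to zero. [cite: Balaban1985Variational, (27) p.282 (bookkeeping)] -/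
theorem pair27_zero_left (δ : Bond (F.P K).d (fun _ => (F.P K).sitesPerDir 0) → Matrix (Fin N) (Fin N) ℂ) :
    pair27 (tauRecCLM N) (0 : NegSizeLit F N K k Ω 3) δ = 0 := by
  have h := B11Eq90Transpose.pair27_sub_left (tauRecCLM N) (0 : NegSizeLit F N K k Ω 3) 0 δ
  rwa [sub_self, sub_self] at h

/-- **`q(Y + δ) = q(Y)` for a scalar-presented `δ`**: by `Delta2Tok` both sides are `−2⟨H♭C⁽²⁾(·), J⟩`, and `C⁽²⁾(Y + δ) = C⁽²⁾(Y)`. [cite: Balaban1985BackgroundPropagators, (3.134) p.422; Balaban1985Variational, (56) p.286] -/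
theorem pair27_delta2Cur_add_scalar (hΔ : Delta2Tok F N K k Ω U₀ levB a hposb hQ Δ2) {δ : Space115Lit F N K k Ω U₀} (hδ : slProjLit F N K k Ω U₀ δ = 0)
    (Y : Space115Lit F N K k Ω U₀) :
    pair27 (tauRecCLM N) (currentCLM (phiRec N) (pairLevLit F Ω k) (nabla115 ((F.P K).eta k) (unitsOfRecord F N U₀)) Δ2 (Y + δ)) (flat115 (Y + δ)) =
      pair27 (tauRecCLM N) (currentCLM (phiRec N) (pairLevLit F Ω k) (nabla115 ((F.P K).eta k) (unitsOfRecord F N U₀)) Δ2 Y) (flat115 Y) := by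
  rw [hΔ (Y + δ), hΔ Y, quadPart_CslOfRecord_add F N K k Ω U₀ levB hδ]

/-- **`q(δ) = 0` for a scalar-presented `δ`** (`q(δ) = q(0 + δ) = q(0) = 0`). [cite: Balaban1985BackgroundPropagators, (3.134) p.422] -/
theorem pair27_delta2Cur_scalar_self (hΔ : Delta2Tok F N K k Ω U₀ levB a hposb hQ Δ2) {δ : Space115Lit F N K k Ω U₀} (hδ : slProjLit F N K k Ω U₀ δ = 0) :
    pair27 (tauRecCLM N) (currentCLM (phiRec N) (pairLevLit F Ω k) (nabla115 ((F.P K).eta k) (unitsOfRecord F N U₀)) Δ2 δ) (flat115 δ) = 0 := by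
  have h := pair27_delta2Cur_add_scalar F N K k Ω U₀ levB a hposb hQ hΔ hδ 0
  rw [zero_add, map_zero, map_zero] at h
  rw [h, pair27_zero_left]

/-- ★ **THE POLAR FORM VANISHES AGAINST SCALAR DIRECTIONS**: `⟨Δ2̂Y, δ⟩₍₂₇₎ = 0` for every `Y` and scalar-presented `δ` (`2B(Y,δ) = q(Y+δ) − q(Y) − q(δ)`, `Delta2SymmTok`).
[cite: Balaban1985BackgroundPropagators, (3.134)–(3.135) p.422; Balaban1985Variational, (27) p.282] -/
theorem pair27_delta2Cur_scalar_right (hΔ : Delta2Tok F N K k Ω U₀ levB a hposb hQ Δ2) (hs : Delta2SymmTok F N K k Ω U₀ Δ2) {δ : Space115Lit F N K k Ω U₀}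
    (hδ : slProjLit F N K k Ω U₀ δ = 0) (Y : Space115Lit F N K k Ω U₀) :
    pair27 (tauRecCLM N) (currentCLM (phiRec N) (pairLevLit F Ω k) (nabla115 ((F.P K).eta k) (unitsOfRecord F N U₀)) Δ2 Y) (flat115 δ) = 0 := by
  have hexp : pair27 (tauRecCLM N) (currentCLM (phiRec N) (pairLevLit F Ω k) (nabla115 ((F.P K).eta k) (unitsOfRecord F N U₀)) Δ2 (Y + δ)) (flat115 (Y + δ)) =
      pair27 (tauRecCLM N) (currentCLM (phiRec N) (pairLevLit F Ω k) (nabla115 ((F.P K).eta k) (unitsOfRecord F N U₀)) Δ2 Y) (flat115 Y) +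
        pair27 (tauRecCLM N) (currentCLM (phiRec N) (pairLevLit F Ω k) (nabla115 ((F.P K).eta k) (unitsOfRecord F N U₀)) Δ2 Y) (flat115 δ) +
        (pair27 (tauRecCLM N) (currentCLM (phiRec N) (pairLevLit F Ω k) (nabla115 ((F.P K).eta k) (unitsOfRecord F N U₀)) Δ2 δ) (flat115 Y) +
          pair27 (tauRecCLM N) (currentCLM (phiRec N) (pairLevLit F Ω k) (nabla115 ((F.P K).eta k) (unitsOfRecord F N U₀)) Δ2 δ) (flat115 δ)) := by
    rw [map_add, map_add, pair27_add_left, pair27_add_right, pair27_add_right]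
  rw [pair27_delta2Cur_add_scalar F N K k Ω U₀ levB a hposb hQ hΔ hδ, pair27_delta2Cur_scalar_self F N K k Ω U₀ levB a hposb hQ hΔ hδ, hs δ Y] at hexp
  have h2 : (2 : ℂ) * pair27 (tauRecCLM N) (currentCLM (phiRec N) (pairLevLit F Ω k) (nabla115 ((F.P K).eta k) (unitsOfRecord F N U₀)) Δ2 Y) (flat115 δ) = 0 := by
    linear_combination -hexp
  exact (mul_eq_zero.1 h2).resolve_left two_ne_zero

/-- **… and on the other side**: `⟨Δ2̂δ, Z⟩₍₂₇₎ = 0` for scalar-presented `δ` and every `Z`. [cite: Balaban1985BackgroundPropagators, (3.134)–(3.135) p.422] -/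
theorem pair27_delta2Cur_scalar_left (hΔ : Delta2Tok F N K k Ω U₀ levB a hposb hQ Δ2) (hs : Delta2SymmTok F N K k Ω U₀ Δ2) {δ : Space115Lit F N K k Ω U₀}
    (hδ : slProjLit F N K k Ω U₀ δ = 0) (Z : Space115Lit F N K k Ω U₀) :
    pair27 (tauRecCLM N) (currentCLM (phiRec N) (pairLevLit F Ω k) (nabla115 ((F.P K).eta k) (unitsOfRecord F N U₀)) Δ2 δ) (flat115 Z) = 0 := by
  rw [hs δ Z]
  exact pair27_delta2Cur_scalar_right F N K k Ω U₀ levB a hposb hQ hΔ hs hδ Z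

/-! ## §2  Consequences for the read current `Δ2̂` -/

/-- ★ **`Δ2̂δ = 0` FOR A SCALAR-PRESENTED `δ`** (perfectness of (27), ✓`eq_of_forall_pair27_eq`). [cite: Balaban1985Variational, (27) p.282; Balaban1985BackgroundPropagators, (3.134) p.422] -/
theorem delta2Cur_scalar_eq_zero (hΔ : Delta2Tok F N K k Ω U₀ levB a hposb hQ Δ2) (hs : Delta2SymmTok F N K k Ω U₀ Δ2) {δ : Space115Lit F N K k Ω U₀}
    (hδ : slProjLit F N K k Ω U₀ δ = 0) :
    currentCLM (phiRec N) (pairLevLit F Ω k) (nabla115 ((F.P K).eta k) (unitsOfRecord F N U₀)) Δ2 δ = 0 := by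
  refine eq_of_forall_pair27_eq F N K k Ω fun d => ?_
  have h := pair27_delta2Cur_scalar_left F N K k Ω U₀ levB a hposb hQ hΔ hs hδ
    ((JetSup.equiv _ _ (nabla115 ((F.P K).eta k) (unitsOfRecord F N U₀))).symm d)
  rw [flat115_apply, Equiv.apply_symm_apply] at h
  rw [h, pair27_zero_left]

/-- ★ **EVERY `Δ2̂Y` IS TRACELESS-VALUED** (test `⟨Δ2̂Y, δ_b·1⟩₍₂₇₎ = η^d·tr (Δ2̂Y)(b) = 0`). [cite: Balaban1985Variational, (27) p.282, (51) p.286; Balaban1985BackgroundPropagators, (3.134) p.422] -/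
theorem trace_delta2Cur_eq_zero (hΔ : Delta2Tok F N K k Ω U₀ levB a hposb hQ Δ2) (hs : Delta2SymmTok F N K k Ω U₀ Δ2) (Y : Space115Lit F N K k Ω U₀)
    (b : Bond (F.P K).d (fun _ => (F.P K).sitesPerDir 0)) :
    (NegSup.equiv (levWeight (F.L : ℝ) ((F.P K).eta k) (bondLevLit F Ω k) 3) (Matrix (Fin N) (Fin N) ℂ)
      (currentCLM (phiRec N) (pairLevLit F Ω k) (nabla115 ((F.P K).eta k) (unitsOfRecord F N U₀)) Δ2 Y) b).trace = 0 := by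
  have hη : ((((F.P K).eta k : ℝ) : ℂ)) ^ (F.P K).d ≠ 0 := pow_ne_zero _ (by exact_mod_cast (Fact.out : 0 < (F.P K).eta k).ne')
  have h := pair27_delta2Cur_scalar_right F N K k Ω U₀ levB a hposb hQ hΔ hs (slProjLit_single115_one F N K k Ω U₀ b) Y
  rw [flat115_single115, pair27_single, mul_one, tauRecCLM_apply] at h
  exact (mul_eq_zero.1 h).resolve_left hη

/-! ## §3  The `L²` operator `Δ2`: `Δ2 ∘ S = 0`, `S ∘ Δ2 = 0`, hence the row `hΔ2S` -/

/-- ★★ **`Δ2` KILLS THE SCALAR-VALUED FIELDS**: `Δ2 (S x) = 0` (`Y ↦ Ŷ` onto, ✓`exists_hat_eq`). [cite: Balaban1985BackgroundPropagators, (3.134) p.422; Balaban1985Variational, (51) p.286] -/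
theorem delta2_scalPartW_eq_zero (hΔ : Delta2Tok F N K k Ω U₀ levB a hposb hQ Δ2) (hs : Delta2SymmTok F N K k Ω U₀ Δ2)
    (x : BondL2K ℂ (F.P K).d (fun _ => (F.P K).sitesPerDir 0) (c0Rec F K k) (WRec N)) : Δ2 (scalPartW N _ x) = 0 := by
  obtain ⟨Y, hY⟩ := exists_hat_eq F N K k Ω U₀ (scalPartW N _ x)
  have hflat : flat115 Y = funEquiv (phiRec N) (fun _ : Bond (F.P K).d (fun _ => (F.P K).sitesPerDir 0) => c0Rec F K k) (scalPartW N _ x) := by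
    rw [← hY, LinearEquiv.apply_symm_apply]
  have hδ : slProjLit F N K k Ω U₀ Y = 0 := by
    refine slProjLit_eq_zero_of_scalar F N K k Ω U₀ fun b => ?_
    obtain ⟨r, hr⟩ := scalPartW_scalar N _ x b
    exact ⟨r, by rw [← flat115_apply, hflat, funEquiv_apply, hr]⟩
  have h0 := delta2Cur_scalar_eq_zero F N K k Ω U₀ levB a hposb hQ hΔ hs hδ
  apply (WL2.equiv ℂ _ (WRec N)).injective
  funext b
  have hb := congrArg (fun Kc => NegSup.equiv (levWeight (F.L : ℝ) ((F.P K).eta k) (bondLevLit F Ω k) 3) (Matrix (Fin N) (Fin N) ℂ) Kc b) h0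
  simp only [equiv_currentCLM, hY, NegSup.equiv_zero, Pi.zero_apply] at hb
  rw [WL2.equiv_zero, Pi.zero_apply]
  exact (phiRec N).map_eq_zero_iff.1 hb

/-- ★★ **THE RANGE OF `Δ2` IS TRACELESS-VALUED**: `S (Δ2 x) = 0`. [cite: Balaban1985BackgroundPropagators, (3.134) p.422; Balaban1985Variational, (51) p.286] -/
theorem scalPartW_delta2_eq_zero (hΔ : Delta2Tok F N K k Ω U₀ levB a hposb hQ Δ2) (hs : Delta2SymmTok F N K k Ω U₀ Δ2)
    (x : BondL2K ℂ (F.P K).d (fun _ => (F.P K).sitesPerDir 0) (c0Rec F K k) (WRec N)) : scalPartW N _ (Δ2 x) = 0 := by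
  rw [scalPartW_eq_zero_iff]
  intro b
  obtain ⟨Y, hY⟩ := exists_hat_eq F N K k Ω U₀ x
  have h := trace_delta2Cur_eq_zero F N K k Ω U₀ levB a hposb hQ hΔ hs Y b
  rw [equiv_currentCLM, hY] at h
  exact h

/-- ★★★ **THE ROW `hΔ2S`: UNDER `Delta2Tok ∧ Delta2SymmTok`, `Δ2` COMMUTES WITH THE SCALAR PART** (both composites vanish) — every `N`, no guard.
[cite: Balaban1985BackgroundPropagators, (3.134)–(3.135) p.422; Balaban1985Variational, (51) p.286] -/
theorem scalPartW_comm_delta2_of_tok (hΔ : Delta2Tok F N K k Ω U₀ levB a hposb hQ Δ2) (hs : Delta2SymmTok F N K k Ω U₀ Δ2)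
    (x : BondL2K ℂ (F.P K).d (fun _ => (F.P K).sitesPerDir 0) (c0Rec F K k) (WRec N)) : Δ2 (scalPartW N _ x) = scalPartW N _ (Δ2 x) := by
  rw [delta2_scalPartW_eq_zero F N K k Ω U₀ levB a hposb hQ hΔ hs, scalPartW_delta2_eq_zero F N K k Ω U₀ levB a hposb hQ hΔ hs]

end Tok

/-! ## §4  ✓`schemeTokOfRecord_two_of_regimeTok` with the `Δ2` data rows discharged -/

section Two

variable (F : T4Family) (K : ℕ) (k : ℕ) (Ω : ℕ → Set (Site (F.P K) 0)) (U₀ : GaugeField (F.P K) 0 (SU 2))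
  [Fact (0 < (F.L : ℝ))] [Fact (0 < (F.P K).eta k)] [Fact (0 < c0Rec F K k)] [Fact (∀ c, 0 < wBRec F K k c)]
  (dom : Set (GaugeField (F.P K) k (SU 2))) (levB : PBond (F.P K) k → ℕ)
  {Gp : SiteL2K ℂ (F.P K).d (fun _ => (F.P K).sitesPerDir 0) (c0Rec F K k) (WRec 2) →ₗ[ℂ]
    SiteL2K ℂ (F.P K).d (fun _ => (F.P K).sitesPerDir 0) (c0Rec F K k) (WRec 2)}
  {Δ2 : BondL2K ℂ (F.P K).d (fun _ => (F.P K).sitesPerDir 0) (c0Rec F K k) (WRec 2) →ₗ[ℂ]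
    BondL2K ℂ (F.P K).d (fun _ => (F.P K).sitesPerDir 0) (c0Rec F K k) (WRec 2)} (a : ℝ)
  (hposπ : ∀ x, x ≠ 0 → 0 < RCLike.re ⟪x, laplaceAOfRecordAt F 2 k U₀ (hessOpOfRecord128 F 2 k U₀ Gp (QflatOfRecord F 2 k) Δ2)
    (QOfRecord F 2 k U₀) (QflatOfRecord F 2 k) a x⟫_ℂ)
  (hposb : ∀ x, x ≠ 0 → 0 < RCLike.re ⟪x, laplaceAOfRecord F 2 k U₀ (QOfRecord F 2 k U₀) (QflatOfRecord F 2 k) a x⟫_ℂ)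
  (hQ : Function.Surjective (QOfRecord F 2 k U₀)) (εC B₀ C₄ a₃ j a𝔄 ε₄ : ℝ) {b C₂ c₄ aC : ℝ}
  (RC : Regime (H1OfRecordAtBgFlat F 2 K k Ω U₀ levB a hposb hQ) 0 (CslOfRecord F 2 K k Ω U₀ levB) b 0 C₂ c₄ 0 aC εC)
  (hCreal : ∀ A : Space115Lit F 2 K k Ω U₀,
    ((JetSup.equiv _ _ (nabla115 ((F.P K).eta k) (unitsOfRecord F 2 U₀))).symm
        (star (JetSup.equiv _ _ (nabla115 ((F.P K).eta k) (unitsOfRecord F 2 U₀)) A)) : Space115Lit F 2 K k Ω U₀) = A →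
    ‖A‖ ≤ εC + aC → ((NegSup.equiv _ _).symm (star (NegSup.equiv _ _ (CslOfRecord F 2 K k Ω U₀ levB A))) :
      NegSize (F.L : ℝ) ((F.P K).eta k) levB 0 (Matrix (Fin 2) (Fin 2) ℂ)) = CslOfRecord F 2 K k Ω U₀ levB A)
  (hCtr : ∀ A : Space115Lit F 2 K k Ω U₀,
    ((JetSup.equiv _ _ (nabla115 ((F.P K).eta k) (unitsOfRecord F 2 U₀))).symm
        (star (JetSup.equiv _ _ (nabla115 ((F.P K).eta k) (unitsOfRecord F 2 U₀)) A)) : Space115Lit F 2 K k Ω U₀) = A →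
    (∀ b, (JetSup.equiv _ _ (nabla115 ((F.P K).eta k) (unitsOfRecord F 2 U₀)) A b).trace = 0) →
    ‖A‖ ≤ εC + aC → ∀ c, (NegSup.equiv _ _ (CslOfRecord F 2 K k Ω U₀ levB A) c).trace = 0)

include RC hCreal hCtr in
set_option maxHeartbeats 1600000 in
/-- ★★★ **def-Y's BUNDLE `SchemeTokOfRecord` FROM `RegimeTok` AT `N = 2`, THE `Δ2` ROWS DISCHARGED**: for the (3.134) datum (`Delta2Tok ∧ Delta2SymmTok`: then `Δ2` is real ✓p821931 AND
commutes with the scalar part, §3), a real `S`-commuting `G′`, the guard, Sect. C's displayed rows (`Regime H♭ 0 C^{𝔰𝔩} …` with `a₃ ≤ a_C`, `Prop4Hyp`, `hCreal`, `hCtr`) and the domain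
(20)-smallness, `RegimeTok` carries the bundle. [cite: Balaban1985Variational, Prop. 6 (115)–(121) p.295; Balaban1985BackgroundPropagators, (3.134) p.422] -/
theorem schemeTokOfRecord_two_of_regimeTok' (h : SmallBelow (avOfRecord F 2 K) k U₀)
    (hGpR : ∀ s, Gp (starW (phiRec 2) s) = starW (phiRec 2) (Gp s)) (hGpS : ∀ s, Gp (scalPartW 2 _ s) = scalPartW 2 _ (Gp s))
    (hΔ : Delta2Tok F 2 K k Ω U₀ levB a hposb hQ Δ2) (hs : Delta2SymmTok F 2 K k Ω U₀ Δ2)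
    (hP : Prop4Hyp (CslOfRecord F 2 K k Ω U₀ levB) C₂ c₄) (haC : a₃ ≤ aC)
    (hR : (bgSchemeOfRecord F 2 K k Ω U₀ dom levB Gp Δ2 a hposπ hposb hQ εC B₀ C₄ a₃ j a𝔄 ε₄).RegimeTok)
    (hdom : ∀ V ∈ dom, ∀ c, ‖(V c : Matrix (Fin 2) (Fin 2) ℂ) * star (Averaging.iter (avOfRecord F 2 K) k U₀ c : Matrix (Fin 2) (Fin 2) ℂ) - 1‖ ≤ 1 / 4) :
    SchemeTokOfRecord F 2 K k Ω U₀ dom levB Gp Δ2 a hposπ hposb hQ εC B₀ C₄ a₃ j a𝔄 ε₄ := by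
  have hΔ2R : ∀ x, Δ2 (starW (phiRec 2) x) = starW (phiRec 2) (Δ2 x) :=
    (realConj_eq_self_iff (phiRec 2) Δ2).1 (realConj_delta2_eq_self F 2 K k Ω U₀ levB a hposb hQ h hΔ hs)
  have hΔ2S : ∀ x, Δ2 (scalPartW 2 _ x) = scalPartW 2 _ (Δ2 x) := scalPartW_comm_delta2_of_tok F 2 K k Ω U₀ levB a hposb hQ hΔ hs
  exact schemeTokOfRecord_of_regimeTok_of_chartSUTok F 2 K k Ω U₀ dom levB Gp a hposπ hposb hQ εC B₀ C₄ a₃ j a𝔄 ε₄ h hΔ hs hR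
    (chartSUTok_bgSchemeOfRecord_two F K k Ω U₀ dom levB a hposπ hposb hQ εC B₀ C₄ a₃ j a𝔄 ε₄ RC hCreal hCtr h hGpR hGpS hΔ2R hΔ2S hP haC hR hdom)

end Two

end Summit.QuantumFields.YangMills.Theorems.N07Delta2OfRecordTraceSectors

end
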